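import Literature.MathematicalPhysics.QuantumFieldTheory.OSReconstructionNoE1
import HarnessLib

/-!
# Self-improvement of exponential bounds for the OS transfer semigroup; vacuum-projected matrix elements

Topic `MathematicalPhysics/QuantumFieldTheory` (families `constructive-qft`, `yang-mills`); theorem-only
sequel of `OSReconstructionNoE1` (the OS Hilbert space `ℋ`, field vectors `Ψ_F^{k}`, vacuum `Ω` and
the positive self-adjoint contraction semigroup `e^{−tH}` of a labelled Schwinger family with E2 and
translation invariance on `⁰𝒮`), consumed by `MassGapFromDiagonalClustering`.

* **Log-convexity with infinite horizon and self-improvement of the constant**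
  (Osterwalder–Schrader 1973, (4.7)–(4.9); Glimm–Jaffe 1987, Thm. 6.1.3):
  `|⟨φ, e^{−(s+t)H} ψ⟩| ≤ ‖e^{−sH}φ‖ ‖e^{−tH}ψ‖` (`norm_inner_transfer_add_le`), hence
  `(Re⟨ψ, e^{−tH}ψ⟩)² ≤ ‖ψ‖² Re⟨ψ, e^{−2tH}ψ⟩`; a bound `Re⟨ψ, e^{−tH}ψ⟩ ≤ C e^{−Δt}` (`t ≥ 0`) with
  ANY constant therefore improves to `‖ψ‖² e^{−Δt}` (`re_inner_transfer_self_le_of_le_exp`, the tree's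
  doubly exponential iteration `le_of_sq_le_mul_succ_of_le_mul_pow` along `t, 2t, 4t, …`); the
  improved bound gives `|⟨φ, e^{−tH}ψ⟩| ≤ e^{−Δt}‖φ‖‖ψ‖` by Cauchy–Schwarz
  (`norm_inner_transfer_le_of_le_exp`) and is stable under finite linear combinations
  (`re_inner_transfer_self_le_sum`).
* **The vacuum component**: `⟨φ − ⟨Ω,φ⟩Ω, e^{−tH}(ψ − ⟨Ω,ψ⟩Ω)⟩ = ⟨φ, e^{−tH}ψ⟩ − ⟨φ,Ω⟩⟨Ω,ψ⟩`
  (`inner_proj_transfer_proj`) and `‖ψ − ⟨Ω,ψ⟩Ω‖ ≤ ‖ψ‖`.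
* **Matrix elements as Schwinger functions**: `⟨Ψ_F^{k}, e^{−tH}Ψ_G^{k'}⟩ = 𝔖_{n+m}^{rev k ++ k'}(ΘF* ⊗ T_tG)`,
  `⟨Ψ_F^{k}, Ω⟩ = 𝔖ₙ^{rev k}(ΘF*)`, `⟨Ω, Ψ_G^{k'}⟩ = 𝔖ₘ^{k'}(G)` (with the reindexing lemma
  `LabelledSchwingerFamily.apply_eq_of_forall_eq_cast` along `0 + m = m`).

References: K. Osterwalder, R. Schrader, CMP 31 (1973) §4.1 (4.3)–(4.9) [OsterwalderSchraderCMP1973];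
J. Glimm, A. Jaffe, *Quantum Physics* (1987) §6.1 Thm. 6.1.3 [GlimmJaffeQP1987].
Mathlib: `norm_inner_le_norm`, `norm_sub_sq`, `inner_self_eq_norm_sq_to_K`.  Tree:
`OSReconstructionNoE1.transfer_add / inner_transfer_left / inner_transfer_self_eq / transfer_vacuum /
transfer_fieldVec / inner_fieldVec_fieldVec / norm_vacuum`, `le_of_sq_le_mul_succ_of_le_mul_pow`.
-/

open scoped SchwartzMap ComplexConjugate InnerProductSpace
open Filter Topology Complex Set
open Literature.MathematicalPhysics.AQFT Literature.MathematicalPhysics.QuantumLattice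

noncomputable section

namespace Literature.MathematicalPhysics.QuantumFieldTheory

universe u

/-! ### Semigroup estimates in the OS Hilbert space -/

namespace OSReconstructionNoE1

variable {ι : Type u} {d : ℕ} [NeZero d] {S : LabelledSchwingerFamily ι (EuclideanSpace ℝ (Fin d))}
variable (h : OSReconstructionNoE1 S)

/-- **Log-convexity, infinite horizon**: `|⟨φ, e^{-(s+t)H} ψ⟩| ≤ ‖e^{-sH} φ‖ ‖e^{-tH} ψ‖` for
`s, t ≥ 0` (semigroup law, symmetry, Cauchy–Schwarz). [cite: OsterwalderSchraderCMP1973, §4.1 eqs. (4.7), (4.9)] -/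
theorem norm_inner_transfer_add_le {s t : ℝ} (hs : 0 ≤ s) (ht : 0 ≤ t) (φ ψ : h.Hilbert) :
    ‖⟪φ, h.transfer (s + t) ψ⟫_ℂ‖ ≤ ‖h.transfer s φ‖ * ‖h.transfer t ψ‖ := by
  rw [h.transfer_add hs ht, ContinuousLinearMap.comp_apply, ← h.inner_transfer_left]
  exact norm_inner_le_norm _ _

/-- `‖e^{-tH} ψ‖² = Re ⟨ψ, e^{-2tH} ψ⟩` for `t ≥ 0`. [cite: GlimmJaffeQP1987, §6.1 Thm. 6.1.3] -/
theorem norm_transfer_sq_eq_re {t : ℝ} (ht : 0 ≤ t) (ψ : h.Hilbert) :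
    ‖h.transfer t ψ‖ ^ 2 = (⟪ψ, h.transfer (2 * t) ψ⟫_ℂ).re := by
  have h1 := h.inner_transfer_self_eq (t := 2 * t) (by positivity) ψ
  rw [show (2 : ℝ) * t / 2 = t by ring] at h1
  rw [h1, Complex.ofReal_re]

/-- `0 ≤ Re ⟨ψ, e^{-tH} ψ⟩` for `t ≥ 0`. [cite: GlimmJaffeQP1987, §6.1 Thm. 6.1.3] -/
theorem re_inner_transfer_self_nonneg {t : ℝ} (ht : 0 ≤ t) (ψ : h.Hilbert) :
    0 ≤ (⟪ψ, h.transfer t ψ⟫_ℂ).re := by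
  rw [h.inner_transfer_self_eq ht, Complex.ofReal_re]
  exact sq_nonneg _

/-- The iteration inequality `(Re ⟨ψ, e^{-tH} ψ⟩)² ≤ ‖ψ‖² Re ⟨ψ, e^{-2tH} ψ⟩`
(Osterwalder–Schrader (4.9)). [cite: OsterwalderSchraderCMP1973, §4.1 eq. (4.9)] -/
theorem re_inner_transfer_self_sq_le {t : ℝ} (ht : 0 ≤ t) (ψ : h.Hilbert) :
    (⟪ψ, h.transfer t ψ⟫_ℂ).re ^ 2 ≤ ‖ψ‖ ^ 2 * (⟪ψ, h.transfer (2 * t) ψ⟫_ℂ).re := by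
  have h1 : (⟪ψ, h.transfer t ψ⟫_ℂ).re ≤ ‖ψ‖ * ‖h.transfer t ψ‖ := by
    refine (le_abs_self _).trans ((Complex.abs_re_le_norm _).trans ?_)
    have := h.norm_inner_transfer_add_le le_rfl ht ψ ψ
    rwa [zero_add, h.transfer_zero, ContinuousLinearMap.id_apply] at this
  calc (⟪ψ, h.transfer t ψ⟫_ℂ).re ^ 2 ≤ (‖ψ‖ * ‖h.transfer t ψ‖) ^ 2 :=
        pow_le_pow_left₀ (h.re_inner_transfer_self_nonneg ht ψ) h1 2
    _ = ‖ψ‖ ^ 2 * (⟪ψ, h.transfer (2 * t) ψ⟫_ℂ).re := by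
        rw [mul_pow, h.norm_transfer_sq_eq_re ht]

/-- **Self-improvement of the constant** (log-convexity with infinite horizon): if
`Re ⟨ψ, e^{-tH} ψ⟩ ≤ C e^{-Δt}` for all `t ≥ 0` with SOME constant `C`, then
`Re ⟨ψ, e^{-tH} ψ⟩ ≤ ‖ψ‖² e^{-Δt}` for all `t ≥ 0` — the doubly exponential iteration of
`(Re ⟨ψ, e^{-tH}ψ⟩)² ≤ ‖ψ‖² Re ⟨ψ, e^{-2tH}ψ⟩` along `t, 2t, 4t, …` against the rescaled bound
(`le_of_sq_le_mul_succ_of_le_mul_pow` with `K = 1`). [cite: OsterwalderSchraderCMP1973, §4.1 eqs. (4.8)–(4.9)] -/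
theorem re_inner_transfer_self_le_of_le_exp {ψ : h.Hilbert} {Δ C : ℝ}
    (hC : ∀ t : ℝ, 0 ≤ t → (⟪ψ, h.transfer t ψ⟫_ℂ).re ≤ C * Real.exp (-Δ * t))
    {t : ℝ} (ht : 0 ≤ t) :
    (⟪ψ, h.transfer t ψ⟫_ℂ).re ≤ ‖ψ‖ ^ 2 * Real.exp (-Δ * t) := by
  set a : ℕ → ℝ := fun n => (⟪ψ, h.transfer (2 ^ n * t) ψ⟫_ℂ).re * Real.exp (Δ * (2 ^ n * t))
    with ha
  have hsq : ∀ n, a n ^ 2 ≤ ‖ψ‖ ^ 2 * a (n + 1) := fun n => by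
    have h2t : (2 : ℝ) ^ (n + 1) * t = 2 * (2 ^ n * t) := by rw [pow_succ]; ring
    have hexp : Real.exp (Δ * (2 ^ n * t)) ^ 2 = Real.exp (Δ * (2 ^ (n + 1) * t)) := by
      rw [← Real.exp_nat_mul, h2t]; push_cast; ring_nf
    have h1 := h.re_inner_transfer_self_sq_le (t := 2 ^ n * t) (by positivity) ψ
    simp only [ha]
    rw [mul_pow, hexp, h2t]
    have h0 : 0 ≤ Real.exp (Δ * (2 * (2 ^ n * t))) := (Real.exp_pos _).le
    rw [show (2 : ℝ) * (2 ^ n * t) = 2 ^ (n + 1) * t from h2t.symm] at h1 h0 ⊢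
    nlinarith [mul_le_mul_of_nonneg_right h1 h0]
  have hbdd : ∀ n, a n ≤ max C 0 * (1 : ℝ) ^ n := fun n => by
    rw [one_pow, mul_one]
    have h1 := hC (2 ^ n * t) (by positivity)
    have h0 : 0 ≤ Real.exp (Δ * (2 ^ n * t)) := (Real.exp_pos _).le
    calc a n ≤ C * Real.exp (-Δ * (2 ^ n * t)) * Real.exp (Δ * (2 ^ n * t)) :=
          mul_le_mul_of_nonneg_right h1 h0
      _ = C := by rw [mul_assoc, ← Real.exp_add]; simp
      _ ≤ max C 0 := le_max_left _ _
  have key := le_of_sq_le_mul_succ_of_le_mul_pow (sq_nonneg ‖ψ‖) le_rfl hbdd hsq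
  have ha0 : a 0 = (⟪ψ, h.transfer t ψ⟫_ℂ).re * Real.exp (Δ * t) := by
    simp [ha]
  rw [ha0] at key
  have hpos : 0 < Real.exp (Δ * t) := Real.exp_pos _
  calc (⟪ψ, h.transfer t ψ⟫_ℂ).re
      = (⟪ψ, h.transfer t ψ⟫_ℂ).re * Real.exp (Δ * t) * Real.exp (-Δ * t) := by
          rw [mul_assoc, ← Real.exp_add]; simp
    _ ≤ ‖ψ‖ ^ 2 * Real.exp (-Δ * t) := mul_le_mul_of_nonneg_right key (Real.exp_pos _).le

/-- **Cauchy–Schwarz transfer bound**: if `Re ⟨φ, e^{-tH} φ⟩ ≤ ‖φ‖² e^{-Δt}` and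
`Re ⟨ψ, e^{-tH} ψ⟩ ≤ ‖ψ‖² e^{-Δt}` for all `t ≥ 0`, then `|⟨φ, e^{-tH} ψ⟩| ≤ e^{-Δt} ‖φ‖ ‖ψ‖`
for all `t ≥ 0`. [cite: GlimmJaffeQP1987, §6.1 Thm. 6.1.3] -/
theorem norm_inner_transfer_le_of_le_exp {φ ψ : h.Hilbert} {Δ : ℝ}
    (hφ : ∀ t : ℝ, 0 ≤ t → (⟪φ, h.transfer t φ⟫_ℂ).re ≤ ‖φ‖ ^ 2 * Real.exp (-Δ * t))
    (hψ : ∀ t : ℝ, 0 ≤ t → (⟪ψ, h.transfer t ψ⟫_ℂ).re ≤ ‖ψ‖ ^ 2 * Real.exp (-Δ * t))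
    {t : ℝ} (ht : 0 ≤ t) :
    ‖⟪φ, h.transfer t ψ⟫_ℂ‖ ≤ Real.exp (-Δ * t) * ‖φ‖ * ‖ψ‖ := by
  have ht2 : 0 ≤ t / 2 := by positivity
  have h1 := h.norm_inner_transfer_add_le ht2 ht2 φ ψ
  rw [add_halves] at h1
  refine h1.trans ?_
  have hφ2 : ‖h.transfer (t / 2) φ‖ ^ 2 ≤ ‖φ‖ ^ 2 * Real.exp (-Δ * t) := by
    rw [h.norm_transfer_sq_eq_re ht2, show 2 * (t / 2) = t by ring]; exact hφ t ht
  have hψ2 : ‖h.transfer (t / 2) ψ‖ ^ 2 ≤ ‖ψ‖ ^ 2 * Real.exp (-Δ * t) := by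
    rw [h.norm_transfer_sq_eq_re ht2, show 2 * (t / 2) = t by ring]; exact hψ t ht
  have hE : 0 ≤ Real.exp (-Δ * t) := (Real.exp_pos _).le
  rw [← sq_le_sq₀ (by positivity) (by positivity)]
  calc (‖h.transfer (t / 2) φ‖ * ‖h.transfer (t / 2) ψ‖) ^ 2
      = ‖h.transfer (t / 2) φ‖ ^ 2 * ‖h.transfer (t / 2) ψ‖ ^ 2 := by ring
    _ ≤ (‖φ‖ ^ 2 * Real.exp (-Δ * t)) * (‖ψ‖ ^ 2 * Real.exp (-Δ * t)) :=
        mul_le_mul hφ2 hψ2 (sq_nonneg _) (by positivity)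
    _ = (Real.exp (-Δ * t) * ‖φ‖ * ‖ψ‖) ^ 2 := by ring

/-- **The improved bound is stable under finite linear combinations** (the vectors with
`Re ⟨v, e^{-tH} v⟩ ≤ ‖v‖² e^{-Δt}` form a subspace): expand, bound each term by Cauchy–Schwarz, and
self-improve the resulting constant. [cite: GlimmJaffeQP1987, §6.1 Thm. 6.1.3] -/
theorem re_inner_transfer_self_le_sum {N : ℕ} (c : Fin N → ℂ) (v : Fin N → h.Hilbert) {Δ : ℝ}
    (hv : ∀ i, ∀ t : ℝ, 0 ≤ t → (⟪v i, h.transfer t (v i)⟫_ℂ).re ≤ ‖v i‖ ^ 2 * Real.exp (-Δ * t))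
    {t : ℝ} (ht : 0 ≤ t) :
    (⟪∑ i, c i • v i, h.transfer t (∑ i, c i • v i)⟫_ℂ).re ≤
      ‖∑ i, c i • v i‖ ^ 2 * Real.exp (-Δ * t) := by
  refine h.re_inner_transfer_self_le_of_le_exp (C := ∑ i, ∑ j, ‖c i‖ * ‖c j‖ * ‖v i‖ * ‖v j‖)
    (fun s hs => ?_) ht
  have hexp : ∀ i j, ‖⟪v i, h.transfer s (v j)⟫_ℂ‖ ≤ Real.exp (-Δ * s) * ‖v i‖ * ‖v j‖ :=
    fun i j => h.norm_inner_transfer_le_of_le_exp (hv i) (hv j) hs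
  have hsum : ⟪∑ i, c i • v i, h.transfer s (∑ j, c j • v j)⟫_ℂ =
      ∑ i, ∑ j, conj (c i) * c j * ⟪v i, h.transfer s (v j)⟫_ℂ := by
    rw [map_sum, sum_inner]
    refine Finset.sum_congr rfl fun i _ => ?_
    rw [inner_sum]
    refine Finset.sum_congr rfl fun j _ => ?_
    rw [map_smul, inner_smul_left, inner_smul_right]
    ring
  refine (le_abs_self _).trans ((Complex.abs_re_le_norm _).trans ?_)
  rw [hsum]
  refine (norm_sum_le _ _).trans ?_
  rw [Finset.sum_mul]
  refine Finset.sum_le_sum fun i _ => (norm_sum_le _ _).trans ?_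
  rw [Finset.sum_mul]
  refine Finset.sum_le_sum fun j _ => ?_
  rw [norm_mul, norm_mul, RCLike.norm_conj]
  calc ‖c i‖ * ‖c j‖ * ‖⟪v i, h.transfer s (v j)⟫_ℂ‖
      ≤ ‖c i‖ * ‖c j‖ * (Real.exp (-Δ * s) * ‖v i‖ * ‖v j‖) :=
        mul_le_mul_of_nonneg_left (hexp i j) (by positivity)
    _ = ‖c i‖ * ‖c j‖ * ‖v i‖ * ‖v j‖ * Real.exp (-Δ * s) := by ring

/-! ### The vacuum component -/

/-- `⟨Ω, e^{-tH} ψ⟩ = ⟨Ω, ψ⟩` (symmetry and `e^{-tH} Ω = Ω`). [cite: GlimmJaffeQP1987, §6.1 Thm. 6.1.3] -/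
theorem inner_vacuum_transfer (t : ℝ) (ψ : h.Hilbert) :
    ⟪h.vacuum, h.transfer t ψ⟫_ℂ = ⟪h.vacuum, ψ⟫_ℂ := by
  rw [← h.inner_transfer_left, h.transfer_vacuum]

/-- `⟨Ω, Ω⟩ = 1` under E0. [folklore] -/
theorem inner_vacuum_vacuum (h0 : S.IsNormalized) : ⟪h.vacuum, h.vacuum⟫_ℂ = 1 := by
  rw [inner_self_eq_norm_sq_to_K, h.norm_vacuum h0]; simp

/-- **The truncated matrix element is the matrix element of the vacuum-projected vectors**:
`⟨φ − ⟨Ω,φ⟩Ω, e^{-tH}(ψ − ⟨Ω,ψ⟩Ω)⟩ = ⟨φ, e^{-tH}ψ⟩ − ⟨φ,Ω⟩⟨Ω,ψ⟩`. [cite: GlimmJaffeQP1987, §6.1 Thm. 6.1.3] -/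
theorem inner_proj_transfer_proj (h0 : S.IsNormalized) (t : ℝ) (φ ψ : h.Hilbert) :
    ⟪φ - ⟪h.vacuum, φ⟫_ℂ • h.vacuum, h.transfer t (ψ - ⟪h.vacuum, ψ⟫_ℂ • h.vacuum)⟫_ℂ =
      ⟪φ, h.transfer t ψ⟫_ℂ - ⟪φ, h.vacuum⟫_ℂ * ⟪h.vacuum, ψ⟫_ℂ := by
  rw [map_sub, map_smul, h.transfer_vacuum, inner_sub_left, inner_sub_right, inner_sub_right,
    inner_smul_right, inner_smul_right, inner_smul_left, inner_smul_left, h.inner_vacuum_transfer,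
    h.inner_vacuum_vacuum h0]
  ring

/-- `‖ψ − ⟨Ω,ψ⟩Ω‖ ≤ ‖ψ‖` (orthogonal projection along the unit vector `Ω`). [folklore] -/
theorem norm_sub_inner_vacuum_smul_le (h0 : S.IsNormalized) (ψ : h.Hilbert) :
    ‖ψ - ⟪h.vacuum, ψ⟫_ℂ • h.vacuum‖ ≤ ‖ψ‖ := by
  have h1 : ‖ψ - ⟪h.vacuum, ψ⟫_ℂ • h.vacuum‖ ^ 2 = ‖ψ‖ ^ 2 - ‖⟪h.vacuum, ψ⟫_ℂ‖ ^ 2 := by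
    rw [@norm_sub_sq ℂ, inner_smul_right, norm_smul, h.norm_vacuum h0, mul_one,
      ← inner_conj_symm ψ h.vacuum, Complex.mul_conj']
    simp only [RCLike.re_to_complex, ← Complex.ofReal_pow, Complex.ofReal_re]
    ring
  nlinarith [norm_nonneg (ψ - ⟪h.vacuum, ψ⟫_ℂ • h.vacuum), norm_nonneg ψ,
    sq_nonneg ‖⟪h.vacuum, ψ⟫_ℂ‖]

/-! ### Matrix elements of field vectors as Schwinger functions -/

section Kinematics

variable {n m : ℕ}

/-- **`⟨Ψ_F^{k}, e^{-tH} Ψ_G^{k'}⟩ = 𝔖_{n+m}^{rev k ++ k'}(ΘF* ⊗ T_t G)`** for `t ≥ 0`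
(Osterwalder–Schrader (4.4), (4.6)). [cite: OsterwalderSchraderCMP1973, §4.1 eqs. (4.4), (4.6)] -/
theorem inner_fieldVec_transfer_fieldVec (k : Fin n → ι) (k' : Fin m → ι)
    {F : 𝓢((Fin n → EuclideanSpace ℝ (Fin d)), ℂ)} {G : 𝓢((Fin m → EuclideanSpace ℝ (Fin d)), ℂ)}
    (hF : IsTimeOrdered F) (hG : IsTimeOrdered G) {t : ℝ} (ht : 0 ≤ t) :
    ⟪h.fieldVec n k F hF, h.transfer t (h.fieldVec m k' G hG)⟫_ℂ =
      S (n + m) (Fin.append (k ∘ Fin.rev) k')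
        ((osAdjoint F).appendTensor (translateMulti (EuclideanSpace.single 0 t) G)) := by
  rw [h.transfer_fieldVec ht, h.inner_fieldVec_fieldVec k k' hF _ (isAppendTensorOf_appendTensor _ _)]

omit [NeZero d] in
/-- Reindexing along an equality of arities: a labelled Schwinger function does not see a cast of the
index type (labels and arguments transported along `Fin.cast`). [folklore] -/
theorem _root_.Literature.MathematicalPhysics.AQFT.LabelledSchwingerFamily.apply_eq_of_forall_eq_cast
    (S : LabelledSchwingerFamily ι (EuclideanSpace ℝ (Fin d))) {a b : ℕ} (e : b = a)
    (kb : Fin b → ι) (ka : Fin a → ι) (H : 𝓢((Fin b → EuclideanSpace ℝ (Fin d)), ℂ))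
    (G : 𝓢((Fin a → EuclideanSpace ℝ (Fin d)), ℂ)) (hk : ∀ i : Fin a, kb (Fin.cast e.symm i) = ka i)
    (hH : ∀ x, H x = G fun i => x (Fin.cast e.symm i)) : S b kb H = S a ka G := by
  subst e
  have hk' : kb = ka := funext fun i => hk i
  have hH' : H = G := by ext x; exact hH x
  rw [hk', hH']

/-- **`⟨Ψ_F^{k}, Ω⟩ = 𝔖ₙ^{rev k}(ΘF*)`** (pairing with the vacuum on the right; `n + 0 = n`
definitionally and `ΘF* ⊗ 1 = ΘF*`). [cite: OsterwalderSchraderCMP1973, §4.1 eq. (4.4) and §4.4] -/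
theorem inner_fieldVec_vacuum (k : Fin n → ι) {F : 𝓢((Fin n → EuclideanSpace ℝ (Fin d)), ℂ)}
    (hF : IsTimeOrdered F) : ⟪h.fieldVec n k F hF, h.vacuum⟫_ℂ = S n (k ∘ Fin.rev) (osAdjoint F) := by
  have hH : IsAppendTensorOf (n := n) (m := 0) (osAdjoint F) (osAdjoint F)
      (SchwartzMap.constOfSubsingleton (D := Fin 0 → EuclideanSpace ℝ (Fin d)) (1 : ℂ)) := by
    intro x
    erw [SchwartzMap.constOfSubsingleton_apply (D := Fin 0 → EuclideanSpace ℝ (Fin d)) (1 : ℂ)]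
    rw [mul_one]
    rfl
  change ⟪h.fieldVec n k F hF, h.fieldVec 0 Fin.elim0 _ isTimeOrdered_constOfSubsingleton⟫_ℂ = _
  rw [h.inner_fieldVec_fieldVec k Fin.elim0 hF _ hH]
  refine S.apply_eq_of_forall_eq_cast (Nat.add_zero n) _ _ _ _ (fun i => ?_) (fun x => ?_)
  · exact Fin.append_left (k ∘ Fin.rev) Fin.elim0 i
  · rfl

/-- **`⟨Ω, Ψ_G^{k'}⟩ = 𝔖ₘ^{k'}(G)`** (pairing with the vacuum on the left; `Θ1* = 1` and the
reindexing `0 + m = m`). [cite: OsterwalderSchraderCMP1973, §4.1 eq. (4.4) and §4.4] -/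
theorem inner_vacuum_fieldVec (k' : Fin m → ι) {G : 𝓢((Fin m → EuclideanSpace ℝ (Fin d)), ℂ)}
    (hG : IsTimeOrdered G) : ⟪h.vacuum, h.fieldVec m k' G hG⟫_ℂ = S m k' G := by
  change ⟪h.fieldVec 0 Fin.elim0 _ isTimeOrdered_constOfSubsingleton, h.fieldVec m k' G hG⟫_ℂ = _
  rw [h.inner_fieldVec_fieldVec Fin.elim0 k' _ hG (isAppendTensorOf_appendTensor _ _)]
  refine S.apply_eq_of_forall_eq_cast (Nat.zero_add m) _ _ _ _ (fun i => ?_) (fun x => ?_)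
  · rw [← Fin.natAdd_zero, Fin.append_right]
  · rw [SchwartzMap.appendTensor_apply, osAdjoint_apply]
    erw [SchwartzMap.constOfSubsingleton_apply (D := Fin 0 → EuclideanSpace ℝ (Fin d)) (1 : ℂ)]
    rw [map_one, one_mul]
    congr 1
    funext i
    rw [Function.comp_apply, Fin.natAdd_zero]

/-- The diagonal OS pairing `⟨Ψ_F, Ψ_F'⟩ = 𝔖₂ₙ^{rev k ++ k}(ΘF* ⊗ F')`. [cite: OsterwalderSchraderCMP1973, §4.1 eq. (4.4)] -/
theorem inner_fieldVec_fieldVec_same (k : Fin n → ι) {F F' : 𝓢((Fin n → EuclideanSpace ℝ (Fin d)), ℂ)}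
    (hF : IsTimeOrdered F) (hF' : IsTimeOrdered F') :
    ⟪h.fieldVec n k F hF, h.fieldVec n k F' hF'⟫_ℂ =
      S (n + n) (Fin.append (k ∘ Fin.rev) k) ((osAdjoint F).appendTensor F') :=
  h.inner_fieldVec_fieldVec k k hF hF' (isAppendTensorOf_appendTensor _ _)

end Kinematics

end OSReconstructionNoE1

end Literature.MathematicalPhysics.QuantumFieldTheory

end
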